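import Summits.Ventures.HSemireg.WedgeHankelRecurrenceGaussChebyshevGrowthOffInterval

/-!
# Venture HSemireg — **MONOTONICITY OFF THE INTERVAL: for `n ≠ 0`, `T_n` and `U_n` are strictly increasing on `[1, ∞)`, `S_n` and `C_n` are strictly increasing on `[2, ∞)`**, with the
# equality cases `T_n(x) = 1 ↔ x = 1`, `U_n(x) = n + 1 ↔ x = 1` (`x ≥ 1`), `C_n(x) = 2 ↔ x = 2`, `S_n(x) = n + 1 ↔ x = 2` (`x ≥ 2`) and the location of all real roots in the OPEN intervals
# `(−1, 1)` (`T_n`, `U_n`) ∕ `(−2, 2)` (`C_n`, `S_n`)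

HONEST FRAMING. Part of the Lean index of the computation cell `pub-hsemireg` (seat p10 gen 49, Sunday typer «UNIFORM-IN-n»).  Real polynomial inequalities only (Mathlib `Polynomial.Chebyshev.T ∕ U ∕
C ∕ S` over `ℝ`, `Real.cosh ∕ arcosh`); no variety, no cohomology theory, no sheaf, no Ext group and no semiregularity map is constructed here; nothing here says that HC / HC_CM / HC_AV holds; no
Literature fact (unproved `Prop`) is declared or used.  Custodian versions as in `WedgeHankelSiegelIdeal` (1/3).
SOURCES (cited).  T. J. Rivlin, *The Chebyshev Polynomials* (Wiley 1974), §1.2, §2.7; V. V. Prasolov, *Polynomials* (Springer 2004), §3.4.3, Thm 3.4.11 (proof: `T_n` increases on `[1, ∞)` —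
LANDED as `Literature.Algebra.Polynomial.ChebyshevSubmultiplicative.eval_T_real_monotoneOn`, the NON-strict `ℕ`-indexed statement; cited (not imported: nothing below needs it), the strict `ℤ`-indexed version below is new).
PROOF TYPED HERE.  (1) `T_n(cosh t) = cosh(nt)` (Mathlib `T_real_cosh`), `cosh` strictly increasing in `|·|` (`Real.cosh_lt_cosh`) and `arcosh` strictly increasing on `[1, ∞)` (`Real.arcosh_lt_arcosh`)
give strict monotonicity of `T_n`, `n ≠ 0`; (2) `U_{m+1} = X·U_m + T_{m+1}` with `U_m ≥ 0` monotone (induction) and `T_{m+1}` strictly monotone gives `U_n`, `n ≥ 1`; (3) `S_n(x) = U_n(x∕2)`,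
`C_n(x) = 2T_n(x∕2)` (N521) transport to `[2, ∞)`; (4) the equality cases follow from strictness and `T_n(1) = 1`, `U_n(1) = n + 1`, `C_n(2) = 2`, `S_n(2) = n + 1` (Mathlib); (5) the root
locations from the growth bounds of N521 (`|U_n| ≥ n + 1 ≥ 1` on `|x| ≥ 1`, etc.) and Mathlib `one_le_abs_eval_T_real`.
DEDUP DISCLOSURE (`rg -ln Chebyshev Literature Summits | xargs rg -n 'StrictMonoOn|MonotoneOn'`, 2026-09-04): only `Literature…ChebyshevSubmultiplicative.eval_T_real_monotoneOn` (cited);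
Mathlib has `roots_T_real ∕ roots_U_real` (explicit roots, from which the open-interval location could also be read off) and `strictAntiOn_node`, but no monotonicity of `T ∕ U ∕ S ∕ C` off
`[−1, 1]` and no `|root| < 1` statement; N500 has the explicit `S ∕ C` root multisets; 0 hits for the 14 names below.

WHAT IS IN THE TREE.  N521 `le_eval_chebyshevU_real`, `le_abs_eval_chebyshevU_real`, `le_abs_eval_chebyshevS_real`, `two_le_abs_eval_chebyshevC_real`, `chebyshevS_eval_eq_U_eval_half`,
`chebyshevC_eval_eq_two_mul_T_eval_half`; `Literature…FitznerVanDerHofstad2017.U_natCast_succ`; Mathlib `T_real_cosh`, `Real.cosh_arcosh`, `Real.arcosh_nonneg`, `Real.arcosh_lt_arcosh`,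
`Real.cosh_lt_cosh`, `T_eval_one`, `U_eval_one`, `C_eval_two`, `S_eval_two`, `one_le_abs_eval_T_real`, `T_ne_zero`, `U_ne_zero`.
THIS FILE (namespace `Summit.Ventures.HSemireg.Wedge.HankelOuter` continued; CHAINED on N521; 0 definitions):
* §1287 **`chebyshevT_real_strictMonoOn`** (`n ∈ ℤ ∖ {0}`, on `[1, ∞)`), `chebyshevU_real_monotoneOn`, **`chebyshevU_real_strictMonoOn`** (`n ≥ 1`, on `[1, ∞)`), `chebyshevS_real_monotoneOn`,
  **`chebyshevS_real_strictMonoOn`**, **`chebyshevC_real_strictMonoOn`** (on `[2, ∞)`); **`chebyshevT_real_eq_one_iff_of_one_le`**, **`chebyshevU_real_eq_iff_of_one_le`**,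
  **`chebyshevC_real_eq_two_iff_of_two_le`**, **`chebyshevS_real_eq_iff_of_two_le`** (equality cases); **`abs_lt_one_of_mem_roots_chebyshevT_real`**, **`abs_lt_one_of_mem_roots_chebyshevU_real`**,
  **`abs_lt_two_of_mem_roots_chebyshevC_real`**, **`abs_lt_two_of_mem_roots_chebyshevS_real`** (all real roots lie in the open interval).
CAVEATS.  Right half-lines only (the left half-lines follow by parity `T_n(−x) = (−1)^n T_n(x)` etc., not typed).  Nothing Ext-side.  New names only.
-/

open Module Polynomial
open scoped Matrix Polynomial

namespace Summit.Ventures.HSemireg.Wedge.HankelOuter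

/-! ## §1287. Monotonicity of `T_n`, `U_n`, `S_n`, `C_n` off the interval -/

/-! ### Strict monotonicity on the right half-line -/

/-- **`T_n` is strictly increasing on `[1, ∞)` for `n ≠ 0`** (`T_n(cosh t) = cosh(nt)`; the non-strict `ℕ`-version is `Literature…ChebyshevSubmultiplicative.eval_T_real_monotoneOn`).
[Prasolov 2004, Thm 3.4.11; Rivlin 1974, §1.2; this file, §1287] -/
theorem chebyshevT_real_strictMonoOn {n : ℤ} (hn : n ≠ 0) : StrictMonoOn (fun x : ℝ => (Polynomial.Chebyshev.T ℝ n).eval x) (Set.Ici 1) := by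
  intro x hx y hy hxy
  simp only [Set.mem_Ici] at hx hy
  show (Polynomial.Chebyshev.T ℝ n).eval x < (Polynomial.Chebyshev.T ℝ n).eval y
  rw [← Real.cosh_arcosh hx, ← Real.cosh_arcosh hy, Polynomial.Chebyshev.T_real_cosh, Polynomial.Chebyshev.T_real_cosh, Real.cosh_lt_cosh, abs_mul, abs_mul]
  have h : |Real.arcosh x| < |Real.arcosh y| := by
    rw [abs_of_nonneg (Real.arcosh_nonneg hx), abs_of_nonneg (Real.arcosh_nonneg hy)]
    exact (Real.arcosh_lt_arcosh (by linarith) (by linarith)).mpr hxy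
  exact mul_lt_mul_of_pos_left h (abs_pos.mpr (Int.cast_ne_zero.mpr hn))

/-- `U_n` is monotone on `[1, ∞)` (all `n ∈ ℕ`; `U_{m+1} = X·U_m + T_{m+1}`). [Rivlin 1974, §1.2; this file, §1287] -/
theorem chebyshevU_real_monotoneOn (n : ℕ) : MonotoneOn (fun x : ℝ => (Polynomial.Chebyshev.U ℝ (n : ℤ)).eval x) (Set.Ici 1) := by
  induction n with
  | zero =>
    intro x _ y _ _
    simp
  | succ m ih =>
    intro x hx y hy hxy
    simp only [Set.mem_Ici] at hx hy
    show (Polynomial.Chebyshev.U ℝ ((m + 1 : ℕ) : ℤ)).eval x ≤ (Polynomial.Chebyshev.U ℝ ((m + 1 : ℕ) : ℤ)).eval y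
    rw [Literature.Probability.FitznerVanDerHofstad2017.U_natCast_succ, eval_add, eval_mul, eval_X, eval_add, eval_mul, eval_X]
    have hU : (Polynomial.Chebyshev.U ℝ (m : ℤ)).eval x ≤ (Polynomial.Chebyshev.U ℝ (m : ℤ)).eval y := ih (Set.mem_Ici.mpr hx) (Set.mem_Ici.mpr hy) hxy
    have hT : (Polynomial.Chebyshev.T ℝ ((m + 1 : ℕ) : ℤ)).eval x ≤ (Polynomial.Chebyshev.T ℝ ((m + 1 : ℕ) : ℤ)).eval y :=
      (chebyshevT_real_strictMonoOn (n := ((m + 1 : ℕ) : ℤ)) (by omega)).monotoneOn (Set.mem_Ici.mpr hx) (Set.mem_Ici.mpr hy) hxy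
    have hUy0 : (0 : ℝ) ≤ (Polynomial.Chebyshev.U ℝ (m : ℤ)).eval y := by
      have h1 := le_eval_chebyshevU_real m hy
      have h2 := Nat.cast_nonneg (α := ℝ) m
      linarith
    nlinarith [mul_le_mul_of_nonneg_left hU (by linarith : (0 : ℝ) ≤ x), mul_le_mul_of_nonneg_right hxy hUy0]

/-- **`U_n` is strictly increasing on `[1, ∞)` for `n ≠ 0`.** [Rivlin 1974, §1.2; this file, §1287] -/
theorem chebyshevU_real_strictMonoOn {n : ℕ} (hn : n ≠ 0) : StrictMonoOn (fun x : ℝ => (Polynomial.Chebyshev.U ℝ (n : ℤ)).eval x) (Set.Ici 1) := by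
  obtain ⟨m, rfl⟩ := Nat.exists_eq_succ_of_ne_zero hn
  intro x hx y hy hxy
  simp only [Set.mem_Ici] at hx hy
  show (Polynomial.Chebyshev.U ℝ ((m + 1 : ℕ) : ℤ)).eval x < (Polynomial.Chebyshev.U ℝ ((m + 1 : ℕ) : ℤ)).eval y
  rw [Literature.Probability.FitznerVanDerHofstad2017.U_natCast_succ, eval_add, eval_mul, eval_X, eval_add, eval_mul, eval_X]
  have hU : (Polynomial.Chebyshev.U ℝ (m : ℤ)).eval x ≤ (Polynomial.Chebyshev.U ℝ (m : ℤ)).eval y :=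
    chebyshevU_real_monotoneOn m (Set.mem_Ici.mpr hx) (Set.mem_Ici.mpr hy) hxy.le
  have hT : (Polynomial.Chebyshev.T ℝ ((m + 1 : ℕ) : ℤ)).eval x < (Polynomial.Chebyshev.T ℝ ((m + 1 : ℕ) : ℤ)).eval y :=
    chebyshevT_real_strictMonoOn (n := ((m + 1 : ℕ) : ℤ)) (by omega) (Set.mem_Ici.mpr hx) (Set.mem_Ici.mpr hy) hxy
  have hUy0 : (0 : ℝ) ≤ (Polynomial.Chebyshev.U ℝ (m : ℤ)).eval y := by
    have h1 := le_eval_chebyshevU_real m hy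
    have h2 := Nat.cast_nonneg (α := ℝ) m
    linarith
  nlinarith [mul_le_mul_of_nonneg_left hU (by linarith : (0 : ℝ) ≤ x), mul_le_mul_of_nonneg_right hxy.le hUy0]

/-- `S_n` is monotone on `[2, ∞)` (all `n ∈ ℕ`; `S_n(x) = U_n(x∕2)`). [Rivlin 1974, §1.2; this file, §1287] -/
theorem chebyshevS_real_monotoneOn (n : ℕ) : MonotoneOn (fun x : ℝ => (Polynomial.Chebyshev.S ℝ (n : ℤ)).eval x) (Set.Ici 2) := by
  intro x hx y hy hxy
  simp only [Set.mem_Ici] at hx hy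
  show (Polynomial.Chebyshev.S ℝ (n : ℤ)).eval x ≤ (Polynomial.Chebyshev.S ℝ (n : ℤ)).eval y
  rw [chebyshevS_eval_eq_U_eval_half, chebyshevS_eval_eq_U_eval_half]
  exact chebyshevU_real_monotoneOn n (Set.mem_Ici.mpr (by linarith)) (Set.mem_Ici.mpr (by linarith)) (by linarith)

/-- **`S_n` is strictly increasing on `[2, ∞)` for `n ≠ 0`.** [Rivlin 1974, §1.2; this file, §1287] -/
theorem chebyshevS_real_strictMonoOn {n : ℕ} (hn : n ≠ 0) : StrictMonoOn (fun x : ℝ => (Polynomial.Chebyshev.S ℝ (n : ℤ)).eval x) (Set.Ici 2) := by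
  intro x hx y hy hxy
  simp only [Set.mem_Ici] at hx hy
  show (Polynomial.Chebyshev.S ℝ (n : ℤ)).eval x < (Polynomial.Chebyshev.S ℝ (n : ℤ)).eval y
  rw [chebyshevS_eval_eq_U_eval_half, chebyshevS_eval_eq_U_eval_half]
  exact chebyshevU_real_strictMonoOn hn (Set.mem_Ici.mpr (by linarith)) (Set.mem_Ici.mpr (by linarith)) (by linarith)

/-- **`C_n` is strictly increasing on `[2, ∞)` for `n ≠ 0`** (`n ∈ ℤ`; `C_n(x) = 2T_n(x∕2)`). [Rivlin 1974, §1.2; this file, §1287] -/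
theorem chebyshevC_real_strictMonoOn {n : ℤ} (hn : n ≠ 0) : StrictMonoOn (fun x : ℝ => (Polynomial.Chebyshev.C ℝ n).eval x) (Set.Ici 2) := by
  intro x hx y hy hxy
  simp only [Set.mem_Ici] at hx hy
  show (Polynomial.Chebyshev.C ℝ n).eval x < (Polynomial.Chebyshev.C ℝ n).eval y
  rw [chebyshevC_eval_eq_two_mul_T_eval_half, chebyshevC_eval_eq_two_mul_T_eval_half]
  have h := chebyshevT_real_strictMonoOn hn (Set.mem_Ici.mpr (by linarith : (1 : ℝ) ≤ x / 2)) (Set.mem_Ici.mpr (by linarith : (1 : ℝ) ≤ y / 2)) (by linarith : x / 2 < y / 2)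
  simp only at h
  linarith

/-! ### Equality cases at the endpoint -/

/-- **For `x ≥ 1` and `n ≠ 0`: `T_n(x) = 1 ↔ x = 1`.** [this file, §1287] -/
theorem chebyshevT_real_eq_one_iff_of_one_le {n : ℤ} (hn : n ≠ 0) {x : ℝ} (hx : 1 ≤ x) : (Polynomial.Chebyshev.T ℝ n).eval x = 1 ↔ x = 1 := by
  refine ⟨fun h => ?_, fun h => by rw [h, Polynomial.Chebyshev.T_eval_one]⟩
  by_contra hne
  have hlt := chebyshevT_real_strictMonoOn hn (Set.mem_Ici.mpr le_rfl) (Set.mem_Ici.mpr hx) (lt_of_le_of_ne hx (Ne.symm hne))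
  simp only [Polynomial.Chebyshev.T_eval_one] at hlt
  linarith

/-- **For `x ≥ 1` and `n ≠ 0`: `U_n(x) = n + 1 ↔ x = 1`.** [this file, §1287] -/
theorem chebyshevU_real_eq_iff_of_one_le {n : ℕ} (hn : n ≠ 0) {x : ℝ} (hx : 1 ≤ x) : (Polynomial.Chebyshev.U ℝ (n : ℤ)).eval x = n + 1 ↔ x = 1 := by
  have h1 : (Polynomial.Chebyshev.U ℝ (n : ℤ)).eval 1 = n + 1 := by
    rw [Polynomial.Chebyshev.U_eval_one]; push_cast; ring
  refine ⟨fun h => ?_, fun h => by rw [h, h1]⟩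
  by_contra hne
  have hlt := chebyshevU_real_strictMonoOn hn (Set.mem_Ici.mpr le_rfl) (Set.mem_Ici.mpr hx) (lt_of_le_of_ne hx (Ne.symm hne))
  simp only [h1] at hlt
  linarith

/-- **For `x ≥ 2` and `n ≠ 0`: `C_n(x) = 2 ↔ x = 2`.** [this file, §1287] -/
theorem chebyshevC_real_eq_two_iff_of_two_le {n : ℤ} (hn : n ≠ 0) {x : ℝ} (hx : 2 ≤ x) : (Polynomial.Chebyshev.C ℝ n).eval x = 2 ↔ x = 2 := by
  refine ⟨fun h => ?_, fun h => by rw [h, Polynomial.Chebyshev.C_eval_two]⟩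
  by_contra hne
  have hlt := chebyshevC_real_strictMonoOn hn (Set.mem_Ici.mpr le_rfl) (Set.mem_Ici.mpr hx) (lt_of_le_of_ne hx (Ne.symm hne))
  simp only [Polynomial.Chebyshev.C_eval_two] at hlt
  linarith

/-- **For `x ≥ 2` and `n ≠ 0`: `S_n(x) = n + 1 ↔ x = 2`.** [this file, §1287] -/
theorem chebyshevS_real_eq_iff_of_two_le {n : ℕ} (hn : n ≠ 0) {x : ℝ} (hx : 2 ≤ x) : (Polynomial.Chebyshev.S ℝ (n : ℤ)).eval x = n + 1 ↔ x = 2 := by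
  have h2 : (Polynomial.Chebyshev.S ℝ (n : ℤ)).eval 2 = n + 1 := by
    rw [Polynomial.Chebyshev.S_eval_two]; push_cast; ring
  refine ⟨fun h => ?_, fun h => by rw [h, h2]⟩
  by_contra hne
  have hlt := chebyshevS_real_strictMonoOn hn (Set.mem_Ici.mpr le_rfl) (Set.mem_Ici.mpr hx) (lt_of_le_of_ne hx (Ne.symm hne))
  simp only [h2] at hlt
  linarith

/-! ### All real roots lie in the open interval -/

/-- **Every real root of `T_n` satisfies `|x| < 1`** (all `n ∈ ℤ`; `T_0 = 1` has none). [Rivlin 1974, §1.2; this file, §1287] -/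
theorem abs_lt_one_of_mem_roots_chebyshevT_real {n : ℤ} {x : ℝ} (hx : x ∈ (Polynomial.Chebyshev.T ℝ n).roots) : |x| < 1 := by
  rw [mem_roots (Polynomial.Chebyshev.T_ne_zero ℝ n), IsRoot.def] at hx
  by_contra h
  have h1 := Polynomial.Chebyshev.one_le_abs_eval_T_real n (not_lt.mp h)
  rw [hx, abs_zero] at h1
  linarith

/-- **Every real root of `U_n` satisfies `|x| < 1`.** [Rivlin 1974, §1.2; this file, §1287] -/
theorem abs_lt_one_of_mem_roots_chebyshevU_real {n : ℕ} {x : ℝ} (hx : x ∈ (Polynomial.Chebyshev.U ℝ (n : ℤ)).roots) : |x| < 1 := by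
  rw [mem_roots (Polynomial.Chebyshev.U_ne_zero ℝ (n : ℤ) (by omega)), IsRoot.def] at hx
  by_contra h
  have h1 := le_abs_eval_chebyshevU_real n (not_lt.mp h)
  rw [hx, abs_zero] at h1
  have h2 := Nat.cast_nonneg (α := ℝ) n
  linarith

/-- **Every real root of `C_n` satisfies `|x| < 2`** (all `n ∈ ℤ`; `C_0 = 2` has none). [Rivlin 1974, §1.2; this file, §1287] -/
theorem abs_lt_two_of_mem_roots_chebyshevC_real {n : ℤ} {x : ℝ} (hx : x ∈ (Polynomial.Chebyshev.C ℝ n).roots) : |x| < 2 := by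
  have hC : Polynomial.Chebyshev.C ℝ n ≠ 0 := fun h0 => by
    have h2 := congrArg (Polynomial.eval (2 : ℝ)) h0
    rw [Polynomial.Chebyshev.C_eval_two, eval_zero] at h2
    norm_num at h2
  rw [mem_roots hC, IsRoot.def] at hx
  by_contra h
  have h1 := two_le_abs_eval_chebyshevC_real n (not_lt.mp h)
  rw [hx, abs_zero] at h1
  linarith

/-- **Every real root of `S_n` satisfies `|x| < 2`.** [Rivlin 1974, §1.2; this file, §1287] -/
theorem abs_lt_two_of_mem_roots_chebyshevS_real {n : ℕ} {x : ℝ} (hx : x ∈ (Polynomial.Chebyshev.S ℝ (n : ℤ)).roots) : |x| < 2 := by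
  have hS : Polynomial.Chebyshev.S ℝ (n : ℤ) ≠ 0 := (chebyshevS_natDegree_monic (R := ℝ) n).2.ne_zero
  rw [mem_roots hS, IsRoot.def] at hx
  by_contra h
  have h1 := le_abs_eval_chebyshevS_real n (not_lt.mp h)
  rw [hx, abs_zero] at h1
  have h2 := Nat.cast_nonneg (α := ℝ) n
  linarith

end Summit.Ventures.HSemireg.Wedge.HankelOuter
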